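import Mathlib
import Summits.CriticalPhenomena.SAWScalingLimit.Theorems.SAWDefectDecoherenceDefectDecoherenceSsDressingPairsAux
import HarnessLib

/-!
# Dressing pairs: the loop-dressed arrivals `Ā_ξ(v) - A_ξ(v)` in every character
(helpers `ss_dressing_pairs`, `ss_dirtyMass_eq_two_mul_leftFirst`, `ss_norm_dressedDefect_le` for
the stub `stub_dressedDefectDecay` of the line `sector-slaving`, crux `DefectDecoherence`,
stmt-CriticalPhenomena-8549)

At a `1`-deep vertex `v` of a simply connected `Λ` with adjacent boundary root `a = s(u,w)`
(`u ∉ Λ ∋ w`), for EVERY character `ξ` (`θ_a = rootAngle u w`, `W` the winding):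
`Ā_ξ(v) - A_ξ(v) = (1 + e^{-iξ·8π/3}) · Σ_{s ∼ v} Σ_{γ : a → s(s,v) dirty, LEFT-FIRST}
x_c^{ℓ+1} e^{-iξ(θ_a + W(γ))}` (`ss_dressing_pairs`), where a dirty arrival
`γ = l₁ ++ v :: h :: l₂` through the dart `s → v` (last vertex `s`, `v` visited earlier) is
LEFT-FIRST when its loop at `v` starts with a left turn: the turning angle at `c_v` from the last
vertex of `l₁` (`u` if `l₁ = []`) to `h` is `+π/3`.  Proof: DCS's pair involution in the
coordinate model and the transport of class-restricted twisted dirty sums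
(`…SsDressingPairsAux.lean`: `ss_hv_pairs`, `ss_dirty_transport`), plus the dictionary
"left turn `↔` `turn = +1`" under the orientation-preserving chart (`ss_leftFirst_iff`).

Corollaries: `ξ = 0`: the dirty mass is twice the left-first dirty mass
(`ss_dirtyMass_eq_two_mul_leftFirst`); `ξ = 13/8`: `‖Ā_D(v) - A_D(v)‖ ≤ (√3/2)·(dirty mass at v)`
(`|1 + e^{-iπ/3}| = √3`; `ss_norm_dressedDefect_le`) — a BOUND on the loop-dressed defect
`dressedDefect` (about `8 %` of the star mass numerically), not a decay: the pair involution alone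
does not give `stub_dressedDefectDecay`; `ξ = -3/8` (`Ā_U = A_U`) is in the auxiliary file.  The
identities agree with exact enumeration on discs of radius `2` (`numerics/hexenum.py`; the
general-`ξ` identity to `3e-18`).

Sources: H. Duminil-Copin, S. Smirnov, Ann. of Math. 175 (2012) (arXiv:1007.0575), §2, proof of
Lemma 1; the line card `Lines/sector-slaving.md`.
-/

noncomputable section

open scoped BigOperators ComplexConjugate Classical
open Literature.Probability.LatticeModels Literature.Probability.RandomPlanarGeometry.SAW
open Summit.CriticalPhenomena.SAWScalingLimit.Theorems.DefectDecoherence.TipMartingale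

namespace Summit.CriticalPhenomena.SAWScalingLimit.Theorems.DefectDecoherence.SectorSlaving

/-! ### Left-first dirty arrivals and the pairing identity on the honeycomb lattice -/

section Pairs

open HV

variable {Λ : Finset HexVertex} {u w₁ v : HexVertex} {Φ : hexGraph ≃g hvGraph} {α β : ℂ}

/-- Splitting a list at a letter occurring in neither prefix is unique (`HV.split_unique`,
verbatim, for arbitrary letters). [folklore] -/
theorem ss_split_unique {α : Type*} {v : α} : ∀ {l₁ m₁ l₂ m₂ : List α}, v ∉ l₁ → v ∉ m₁ →
    l₁ ++ v :: l₂ = m₁ ++ v :: m₂ → l₁ = m₁ ∧ l₂ = m₂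
  | [], [], _, _, _, _, h => by simpa using h
  | [], b :: m₁, _, _, _, hm, h => by
    simp only [List.nil_append, List.cons_append, List.cons.injEq] at h
    obtain ⟨rfl, -⟩ := h
    exact absurd List.mem_cons_self hm
  | a :: l₁, [], _, _, hl, _, h => by
    simp only [List.nil_append, List.cons_append, List.cons.injEq] at h
    obtain ⟨rfl, -⟩ := h
    exact absurd List.mem_cons_self hl
  | a :: l₁, b :: m₁, _, _, hl, hm, h => by
    simp only [List.cons_append, List.cons.injEq] at h
    obtain ⟨rfl, h⟩ := h
    obtain ⟨h1, h2⟩ := ss_split_unique (List.not_mem_of_not_mem_cons hl)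
      (List.not_mem_of_not_mem_cons hm) h
    exact ⟨by rw [h1], h2⟩

/-- **Left-first, transported.**  A dirty arrival `γ` at `v` through the dart `s → v` decomposes
as `γ = l₁ ++ v :: h :: l₂`; its loop at `v` starts with a LEFT turn — the turning angle of the
embedded walk at `c_v`, coming from the last vertex of `l₁` (from `u` if `l₁ = []`) and going to
`h`, is `+π/3` — iff the code of `γ` is a left-first loop walk of the coordinate model
(`turn = +1`; the chart is an orientation-preserving similarity). [folklore] -/
theorem ss_leftFirst_iff (hu : u ∉ Λ) (hΦu : Φ u = wOut) (hΦw : Φ w₁ = hvOrigin)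
    (haff : ∀ f, emb (pos (Φ f)) = α * hexCenter f + β) (hα : α ≠ 0)
    (hwV : wOut ∉ Λ.map Φ.toEquiv.toEmbedding) {s : HexVertex} (hvs : hexGraph.Adj v s)
    (γ : HexMidEdgeSAW Λ s(u, w₁) s(s, v)) (hlast : γ.verts.getLast? = some s)
    (hvγ : v ∈ γ.verts) :
    (∃ (l₁ l₂ : List HexVertex) (h : HexVertex), γ.verts = l₁ ++ v :: h :: l₂ ∧
        turning (hexCenter (l₁.getLast?.getD u)) (hexCenter v) (hexCenter h) = Real.pi / 3) ↔
      ∃ (n₁ n₂ : List HV) (h : HV), Φ v ∉ n₁ ∧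
        wOut :: (γ.verts.map Φ ++ [Φ v]) = lw n₁ (Φ v) (h :: n₂) ∧ turn (lwS n₁) (Φ v) h = 1 := by
  have hne : γ.verts ≠ [] := by rintro h; simp [h] at hlast
  have hl : γ.verts.getLast hne = s :=
    Option.some_injective _ ((List.getLast?_eq_some_getLast hne).symm.trans hlast)
  -- the decomposition at `v`
  obtain ⟨l₁, L, hdec⟩ := List.append_of_mem hvγ
  have hnotin : ∀ {l₁' : List HexVertex} {L' : List HexVertex}, γ.verts = l₁' ++ v :: L' →
      v ∉ l₁' := by
    intro l₁' L' hdec' hv'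
    have hnd := γ.nodup
    rw [hdec'] at hnd
    exact (List.nodup_append.1 hnd).2.2 v hv' v List.mem_cons_self rfl
  have hvl₁ : v ∉ l₁ := hnotin hdec
  have hL : L ≠ [] := by
    rintro rfl
    have : γ.verts.getLast hne = v := by simp [hdec]
    exact hvs.ne (this.symm.trans hl)
  obtain ⟨h, l₂, rfl⟩ := List.exists_cons_of_ne_nil hL
  -- the code is the loop walk `lw (Φ l₁) (Φ v) (Φ (h :: l₂))`
  have hc : wOut :: (γ.verts.map Φ ++ [Φ v]) = lw (l₁.map Φ) (Φ v) (Φ h :: l₂.map Φ) := by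
    rw [hdec]; simp [HV.lw]
  have hxm : Φ v ∉ l₁.map Φ := by rw [List.mem_map_of_injective Φ.injective]; exact hvl₁
  have hS : lwS (l₁.map Φ) = Φ (l₁.getLast?.getD u) := by
    rcases l₁.eq_nil_or_concat' with rfl | ⟨L₀, p, rfl⟩
    · simp [HV.lwS, hΦu]
    · simp [HV.lwS]
  -- the entrance, `v` and `h` in the coordinate model
  have he : (γ.verts.getLast hne = s ∧ v = v) ∨ (γ.verts.getLast hne = v ∧ v = s) :=
    Or.inl ⟨hl, rfl⟩
  have hmw := γ.isMidWalk_code Φ rfl hu hΦu hΦw hvs.symm hne he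
  rw [hc] at hmw
  obtain ⟨hxp, hxh, -, hph, -⟩ := lw_nbrs_of_not_mem hwV hmw (List.cons_ne_nil _ _)
  rw [hS] at hxp hph
  simp only [List.head_cons] at hxh hph
  have key : turning (hexCenter (l₁.getLast?.getD u)) (hexCenter v) (hexCenter h) =
      Real.pi / 3 * turn (Φ (l₁.getLast?.getD u)) (Φ v) (Φ h) := by
    rw [← turning_affine hα β, ← haff, ← haff, ← haff]
    exact turning_emb_pos hxp.symm hxh hph
  rw [hc, ss_hv_leftFirst_lw_iff hxm (List.cons_ne_nil _ _), List.head_cons, hS]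
  constructor
  · rintro ⟨l₁', l₂', h', hdec', ht'⟩
    obtain ⟨rfl, h2⟩ := ss_split_unique hvl₁ (hnotin hdec') (hdec.symm.trans hdec')
    obtain ⟨rfl, -⟩ := List.cons.inj h2
    rw [key] at ht'
    have : (turn (Φ (l₁.getLast?.getD u)) (Φ v) (Φ h) : ℝ) = 1 := by
      have hπ : Real.pi / 3 ≠ 0 := by positivity
      field_simp at ht'
      linarith
    exact_mod_cast this
  · intro ht
    refine ⟨l₁, l₂, h, hdec, ?_⟩
    rw [key, ht]
    push_cast
    ring

/-- **The pairing identity of the loop-dressed arrivals, every character `ξ`** (registered helper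
`ss_dressing_pairs`).  At a `1`-deep vertex `v` of a simply connected `Λ` with adjacent boundary
root `a = s(u,w)` (`u ∉ Λ ∋ w`): the loop-dressed (dirty) part `Ā_ξ(v) - A_ξ(v)` of the via-dart
sum equals `(1 + e^{-iξ·8π/3})` times the twisted sum over the LEFT-FIRST dirty arrivals (those
whose loop at `v` starts with a left turn, turning angle `+π/3` at `c_v`).  DCS's pair involution
(traverse the loop the other way) maps left-first onto right-first dirty arrivals, preserving the
length and adding `8π/3` to the winding (`a` on the boundary, `Ω` simply connected).  At
`ξ = -3/8` the factor vanishes (the vertex relation in sector form), at `ξ = 0` it is `2`, at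
`ξ = 5/8, 13/8` it has modulus `√3` (Duminil-Copin–Smirnov 2012, proof of Lemma 1). [folklore] -/
theorem ss_dressing_pairs : ∀ (Λ : Finset HexVertex), hexDomainSimplyConnected Λ →
    ∀ (u w : HexVertex), hexGraph.Adj u w → u ∉ Λ → w ∈ Λ →
      ∀ v : HexVertex, Deep Λ v 1 → ∀ ξ : ℝ,
        viaSum Λ s(u, w) (rootAngle u w) ξ v - arrivalSum Λ s(u, w) (rootAngle u w) ξ v =
          (1 + Complex.exp (-Complex.I * ξ * ((8 * Real.pi / 3 : ℝ) : ℂ))) *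
            ∑ s ∈ star Λ v, ∑ γ : HexMidEdgeSAW Λ s(u, w) s(s, v),
              if γ.verts.getLast? = some s ∧
                  (∃ (l₁ l₂ : List HexVertex) (h : HexVertex), γ.verts = l₁ ++ v :: h :: l₂ ∧
                    turning (hexCenter (l₁.getLast?.getD u)) (hexCenter v) (hexCenter h) =
                      Real.pi / 3) then
                (xc : ℂ) ^ (γ.length + 1) *
                  Complex.exp (-Complex.I * ξ * ((rootAngle u w + γ.winding : ℝ) : ℂ))
              else 0 := by
  intro Λ hΛsc u w huw hu hw v hdeep ξ
  have hΛ : ∀ t, hexGraph.Adj v t → t ∈ Λ := fun t ht =>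
    hdeep t (dist_hexCenter_le_one_of_adj ht.symm)
  obtain ⟨Φ, α, β, hα, hΦu, hΦw, haff⟩ := exists_chart huw
  have hwV : wOut ∉ Λ.map Φ.toEquiv.toEmbedding := by
    intro h
    obtain ⟨y, hy, hyu⟩ := Finset.mem_map.1 h
    change Φ y = wOut at hyu
    exact hu (Φ.injective (hyu.trans hΦu.symm) ▸ hy)
  have h₀ := fun c hc hcyc => wnd_eq_zero_of_simplyConnected (Φ := Φ) hΛsc hu hΦu c hc hcyc
  -- Steps 1, 2: the dirty sum, transported (all dirty arrivals ↔ all loop walks at `Φ v`)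
  have h2 := ss_dirty_transport hu hw huw hΦu hΦw haff hα hΛ (fun _ => True) (fun _ => True)
    (fun _ _ _ _ _ => Iff.rfl) ξ (rootAngle u w)
  rw [Finset.filter_true] at h2
  simp only [and_true] at h2
  -- Step 3: the pair involution; Step 4: back (left-first ↔ left-first)
  have h4 := ss_dirty_transport hu hw huw hΦu hΦw haff hα hΛ
    (fun l => ∃ (l₁ l₂ : List HexVertex) (h : HexVertex), l = l₁ ++ v :: h :: l₂ ∧
      turning (hexCenter (l₁.getLast?.getD u)) (hexCenter v) (hexCenter h) = Real.pi / 3)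
    (fun P => ∃ (n₁ n₂ : List HV) (h : HV), Φ v ∉ n₁ ∧ P = lw n₁ (Φ v) (h :: n₂) ∧
      turn (lwS n₁) (Φ v) h = 1)
    (fun s hvs γ hlast hvγ => ss_leftFirst_iff hu hΦu hΦw haff hα hwV hvs γ hlast hvγ)
    ξ (rootAngle u w)
  rw [ss_dirtySum_eq, h2, ss_hv_pairs hwV h₀ ξ (rootAngle u w), ← h4]
  congr 1
  refine Finset.sum_congr rfl fun s _ => Finset.sum_congr rfl fun γ _ => if_congr ?_ rfl rfl
  constructor
  · rintro ⟨hl, -, hP⟩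
    exact ⟨hl, hP⟩
  · rintro ⟨hl, l₁, l₂, h, hdec, ht⟩
    exact ⟨hl, by rw [hdec]; simp, l₁, l₂, h, hdec, ht⟩

end Pairs

/-! ### Corollaries: the sectors `U` (no dressing), `0` (dirty mass) and `D` (the bound) -/

section Corollaries

variable {Λ : Finset HexVertex} {u w v : HexVertex}

/-- `‖1 + e^{-i(13/8)(8π/3)}‖ = ‖1 + e^{-iπ/3}‖ = √3`. [folklore] -/
theorem ss_norm_phase_defect :
    ‖1 + Complex.exp (-Complex.I * ((13 / 8 : ℝ) : ℂ) * ((8 * Real.pi / 3 : ℝ) : ℂ))‖ =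
      Real.sqrt 3 := by
  have e : Complex.exp (-Complex.I * ((13 / 8 : ℝ) : ℂ) * ((8 * Real.pi / 3 : ℝ) : ℂ)) =
      Complex.exp (((-(Real.pi / 3) : ℝ) : ℂ) * Complex.I) := by
    rw [show -Complex.I * ((13 / 8 : ℝ) : ℂ) * ((8 * Real.pi / 3 : ℝ) : ℂ) =
        ((-(Real.pi / 3) : ℝ) : ℂ) * Complex.I + ((-2 : ℤ) : ℂ) * (2 * Real.pi * Complex.I) by
      push_cast; ring, Complex.exp_add, Complex.exp_int_mul_two_pi_mul_I, mul_one]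
  set z := 1 + Complex.exp (((-(Real.pi / 3) : ℝ) : ℂ) * Complex.I) with hz
  have hre : z.re = 3 / 2 := by
    rw [hz, Complex.add_re, Complex.one_re, Complex.exp_ofReal_mul_I_re, Real.cos_neg,
      Real.cos_pi_div_three]
    norm_num
  have him : z.im = -(Real.sqrt 3 / 2) := by
    rw [hz, Complex.add_im, Complex.one_im, Complex.exp_ofReal_mul_I_im, Real.sin_neg,
      Real.sin_pi_div_three]
    ring
  have h3 : Real.sqrt 3 ^ 2 = 3 := Real.sq_sqrt (by norm_num)
  have hsq : ‖z‖ ^ 2 = 3 := by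
    rw [Complex.sq_norm, Complex.normSq_apply, hre, him]
    nlinarith [h3]
  rw [e, ← hz, ← Real.sqrt_sq (norm_nonneg z), hsq]

/-- **The dirty mass is twice the left-first dirty mass** (registered helper
`ss_dirtyMass_eq_two_mul_leftFirst`; `ξ = 0`: the pair involution is a length-preserving
bijection from the left-first onto the right-first dirty arrivals). [folklore] -/
theorem ss_dirtyMass_eq_two_mul_leftFirst : ∀ (Λ : Finset HexVertex), hexDomainSimplyConnected Λ →
    ∀ (u w : HexVertex), hexGraph.Adj u w → u ∉ Λ → w ∈ Λ →
      ∀ v : HexVertex, Deep Λ v 1 →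
        (∑ s ∈ star Λ v, ∑ γ : HexMidEdgeSAW Λ s(u, w) s(s, v),
          (if γ.verts.getLast? = some s ∧ v ∈ γ.verts then xc ^ (γ.length + 1) else 0 : ℝ)) =
        2 * ∑ s ∈ star Λ v, ∑ γ : HexMidEdgeSAW Λ s(u, w) s(s, v),
          (if γ.verts.getLast? = some s ∧
              (∃ (l₁ l₂ : List HexVertex) (h : HexVertex), γ.verts = l₁ ++ v :: h :: l₂ ∧
                turning (hexCenter (l₁.getLast?.getD u)) (hexCenter v) (hexCenter h) =
                  Real.pi / 3) then xc ^ (γ.length + 1) else 0 : ℝ) := by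
  intro Λ hΛ u w huw hu hw v hdeep
  have h := ss_dressing_pairs Λ hΛ u w huw hu hw v hdeep 0
  have e2 : (1 + Complex.exp (-Complex.I * ((0 : ℝ) : ℂ) * ((8 * Real.pi / 3 : ℝ) : ℂ))) = 2 := by
    rw [Complex.ofReal_zero, mul_zero, zero_mul, Complex.exp_zero]; norm_num
  rw [e2] at h
  -- the `ξ = 0` sums are the real masses
  have hph : ∀ θ : ℝ, Complex.exp (-Complex.I * ((0 : ℝ) : ℂ) * ((θ : ℝ) : ℂ)) = 1 := fun θ => by
    rw [Complex.ofReal_zero, mul_zero, zero_mul, Complex.exp_zero]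
  simp only [hph, mul_one] at h
  have hd : viaSum Λ s(u, w) (rootAngle u w) 0 v - arrivalSum Λ s(u, w) (rootAngle u w) 0 v =
      ((∑ s ∈ star Λ v, ∑ γ : HexMidEdgeSAW Λ s(u, w) s(s, v),
          (if γ.verts.getLast? = some s ∧ v ∈ γ.verts then xc ^ (γ.length + 1) else 0 : ℝ) : ℝ) : ℂ) := by
    unfold viaSum arrivalSum
    rw [← Finset.sum_sub_distrib, Complex.ofReal_sum]
    refine Finset.sum_congr rfl fun s _ => ?_
    rw [← Finset.sum_sub_distrib, Complex.ofReal_sum]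
    refine Finset.sum_congr rfl fun γ _ => ?_
    by_cases hl : γ.verts.getLast? = some s <;> by_cases hvγ : v ∈ γ.verts <;> simp [hl, hvγ]
  rw [hd] at h
  apply Complex.ofReal_injective
  rw [h]
  push_cast
  congr 1
  refine Finset.sum_congr rfl fun s _ => Finset.sum_congr rfl fun γ _ => ?_
  split_ifs <;> simp

/-- **Bound on the loop-dressed defect** (registered helper `ss_norm_dressedDefect_le`): at a
`1`-deep vertex of a simply connected `Λ` with adjacent boundary root,
`‖Ā_D(v) - A_D(v)‖ ≤ (√3/2) · (dirty arrival mass at v)` — the pairing factor at `ξ = 13/8` has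
modulus `√3`, the left-first twisted sum is bounded by the left-first mass, which is half the
dirty mass.  Boundedness, not decay: the decay of the dressed defect is NOT a consequence of the
pair involution. [folklore] -/
theorem ss_norm_dressedDefect_le : ∀ (Λ : Finset HexVertex), hexDomainSimplyConnected Λ →
    ∀ (u w : HexVertex), hexGraph.Adj u w → u ∉ Λ → w ∈ Λ →
      ∀ v : HexVertex, Deep Λ v 1 →
        ‖dressedDefect Λ u w v‖ ≤ Real.sqrt 3 / 2 *
          ∑ s ∈ star Λ v, ∑ γ : HexMidEdgeSAW Λ s(u, w) s(s, v),
            (if γ.verts.getLast? = some s ∧ v ∈ γ.verts then xc ^ (γ.length + 1) else 0 : ℝ) := by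
  intro Λ hΛ u w huw hu hw v hdeep
  rw [dressedDefect, ss_dressing_pairs Λ hΛ u w huw hu hw v hdeep (13 / 8), norm_mul,
    ss_norm_phase_defect, ss_dirtyMass_eq_two_mul_leftFirst Λ hΛ u w huw hu hw v hdeep,
    ← mul_assoc, show Real.sqrt 3 / 2 * 2 = Real.sqrt 3 by ring]
  refine mul_le_mul_of_nonneg_left ?_ (Real.sqrt_nonneg 3)
  refine (norm_sum_le _ _).trans (Finset.sum_le_sum fun s _ => ?_)
  refine (norm_sum_le _ _).trans (Finset.sum_le_sum fun γ _ => ?_)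
  exact norm_ite_phase_le _ _ _

end Corollaries




end Summit.CriticalPhenomena.SAWScalingLimit.Theorems.DefectDecoherence.SectorSlaving

end
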